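import Literature.Topology.FourManifolds.K1Loop2
import HarnessLib

/-!
# The finger knot `K₁`, III: the controlled descent from the upper tip (mirror facts)

Topic `Literature/Topology/FourManifolds`; fact seat `provefact-IsStrictHandleSlide.isSurgery`
(R. C. Kirby, *The Topology of 4-Manifolds*, LNM 1374 (1989), Ch. I §4, Fig. 4.2; remaining content:
the named fact (S) `Literature.Topology.FourManifolds.FramedLink.IsStrictHandleSlide.slideModel`).
`K1Loop2.lean` proved the radial facts of the lower half of the fingertip (`rsl`). This file proves
the mirror facts for the upper half (`rsu`, the clamped blend of the upper rise radius `rup` into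
the gentle line `rmu`), approaching the upper tip `h_Dᵘ` from below: on `[h_Dᵘ - β, h_Dᵘ]` the rise
radius increases at rate in `[λ, s_max]` (`deriv_rup_ge_zone`, `deriv_rup_le_zone`), the blend
increases at rate `≥ λ` up to the tip and exactly `λ` below the blend zone, hence
`rsu' ≥ 0` below the tip, `rsu' ≥ λ` on `[h_gᵘ, h_Dᵘ]`, `rsu' ≤ (1 + C_T) λ` below the blend zone, and
`rsu ∈ [r_low, r_Dᵘ]` (`rsu_mem'`). With `FingerMonotone.lean` (in the reflected height) this makes
the upper fingertip half a graph over the twisted height.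

## References

* R. C. Kirby, *The Topology of 4-Manifolds*, LNM 1374, Springer (1989), Ch. I §4. [Kirby1989]
-/

open scoped Topology ContDiff
open Set Real Filter

noncomputable section

namespace Literature.Topology.FourManifolds

namespace K1Loop2Data

variable (L : K1Loop2Data)

/-! ### The upper rise near the upper tip (reflected heights `h' = 1 - h`) -/

/-- The reflected tip height of the upper track: `hDu = 1 - h_D'` with `h_D' = Hhᵘ t_Dᵘ`. [folklore] -/
theorem hDu_eq : L.hDu = 1 - L.du.Hh L.du.tD := rfl

/-- The level `Hhᵘ t_Lᵘ` is at least `κ_Dᵘ / Mρ` above the reflected tip height. [folklore] -/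
theorem hD'_add_le_Hh_tL : L.du.Hh L.du.tD + L.du.κD / L.Mρ ≤ L.du.Hh L.du.tL := by
  have hmono : ∀ x y, x ≤ y → L.du.ρt y - L.du.ρt x ≤ L.Mρ * (y - x) := by
    intro x y hxy
    have hanti : AntitoneOn (fun u ↦ L.du.ρt u - L.Mρ * u) (Icc x y) := by
      refine antitoneOn_of_deriv_nonpos (convex_Icc _ _)
        ((L.du.contDiff_ρt.continuous.sub (continuous_const.mul continuous_id)).continuousOn)
        (((L.du.contDiff_ρt.differentiable (by simp)).sub ((differentiable_const _).mul differentiable_id)).differentiableOn)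
        fun u _ ↦ ?_
      have hd : HasDerivAt (fun u ↦ L.du.ρt u - L.Mρ * u) (deriv L.du.ρt u - L.Mρ * 1) u :=
        ((L.du.contDiff_ρt.differentiable (by simp) u).hasDerivAt).sub ((hasDerivAt_id u).const_mul _)
      rw [hd.deriv]; linarith [L.ρt_deriv_le' u]
    have := hanti ⟨le_rfl, hxy⟩ ⟨hxy, le_rfl⟩ hxy
    simp only at this; linarith
  have hle : L.du.Hh L.du.tD ≤ L.du.Hh L.du.tL :=
    L.du.Hh_le_Hh L.du.tD_lt_tL.le (by linarith [L.du.tL_mem.2, L.du.ε_pos])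
  have h := hmono _ _ hle
  have e1 : L.du.ρt (L.du.Hh L.du.tL) = 1 := L.du.Xl_tL
  have e2 : L.du.ρt (L.du.Hh L.du.tD) = L.du.xD := L.du.Xl_tD
  rw [e1, e2, K2LiteData.xD] at h
  have hM := L.Mρ_pos
  have : L.du.κD / L.Mρ ≤ L.du.Hh L.du.tL - L.du.Hh L.du.tD := by
    rw [div_le_iff₀ hM]; nlinarith
  linarith

/-- The reflected blend zone: for `h ∈ [hDu - β, hDu]`, `1 - h ∈ [h_D', h_D' + β]`, below `Hhᵘ t_Lᵘ`. [folklore] -/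
theorem refl_zone {h : ℝ} (hh : h ∈ Icc (L.hDu - L.β) L.hDu) :
    1 - h ∈ Icc (L.du.Hh L.du.tD) (L.du.Hh L.du.tD + L.β) ∧ 1 - h ≤ L.du.Hh L.du.tL := by
  have h1 := L.hD'_add_le_Hh_tL; have h2 := L.β_le'
  have h3 : L.du.κD / (2 * L.Mρ) ≤ L.du.κD / L.Mρ := by
    apply div_le_div_of_nonneg_left L.du.κD_pos.le L.Mρ_pos; linarith [L.Mρ_pos]
  rw [hDu_eq] at hh
  exact ⟨⟨by linarith [hh.2], by linarith [hh.1]⟩, by linarith [hh.1]⟩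

/-- On the reflected blend zone the upper rise profile has slope at least `vminᵘ / MHᵘ`. [folklore] -/
theorem deriv_ρt_ge' {h : ℝ} (hh : h ∈ Icc (L.hDu - L.β) L.hDu) : L.du.vmin / L.du.MH ≤ deriv L.du.ρt (1 - h) := by
  obtain ⟨hz, hzL⟩ := L.refl_zone hh
  have hc : ContinuousOn L.du.Hh (Icc L.du.tD L.du.tL) := L.du.contDiff_Hh.continuous.continuousOn
  have hmem : 1 - h ∈ Icc (L.du.Hh L.du.tD) (L.du.Hh L.du.tL) := ⟨hz.1, hzL⟩
  obtain ⟨τ, hτ, hτh⟩ := intermediate_value_Icc L.du.tD_lt_tL.le hc hmem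
  have hX := L.du.vmin_le_dXl hτ
  rw [(L.du.hasDerivAt_Xl τ).deriv, hτh] at hX
  have hH := L.du.deriv_Hh_le_MH ⟨(L.du.I_sub hτ).1, L.du.le_bε hτ⟩
  have hρ0 := L.du.deriv_ρt_nonneg (1 - h)
  rw [div_le_iff₀ L.du.MH_pos]
  nlinarith [mul_le_mul_of_nonneg_left hH hρ0]

/-- On the reflected blend zone `ρtᵘ (1 - h) ∈ [x_Dᵘ, 1 - κ_Dᵘ/2]`. [folklore] -/
theorem ρt_mem_zone' {h : ℝ} (hh : h ∈ Icc (L.hDu - L.β) L.hDu) : L.du.ρt (1 - h) ∈ Icc L.du.xD (1 - L.du.κD / 2) := by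
  obtain ⟨hz, -⟩ := L.refl_zone hh
  have h1 : L.du.xD ≤ L.du.ρt (1 - h) := by rw [← L.du.ρt_Hh_tD]; exact L.du.monotone_ρt hz.1
  refine ⟨h1, ?_⟩
  have hanti : AntitoneOn (fun u ↦ L.du.ρt u - L.Mρ * u) (Icc (L.du.Hh L.du.tD) (1 - h)) := by
    refine antitoneOn_of_deriv_nonpos (convex_Icc _ _)
      ((L.du.contDiff_ρt.continuous.sub (continuous_const.mul continuous_id)).continuousOn)
      (((L.du.contDiff_ρt.differentiable (by simp)).sub ((differentiable_const _).mul differentiable_id)).differentiableOn)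
      fun u _ ↦ ?_
    have hd : HasDerivAt (fun u ↦ L.du.ρt u - L.Mρ * u) (deriv L.du.ρt u - L.Mρ * 1) u :=
      ((L.du.contDiff_ρt.differentiable (by simp) u).hasDerivAt).sub ((hasDerivAt_id u).const_mul _)
    rw [hd.deriv]; linarith [L.ρt_deriv_le' u]
  have := hanti ⟨le_rfl, hz.1⟩ ⟨hz.1, le_rfl⟩ hz.1
  simp only at this
  have e2 : L.du.ρt (L.du.Hh L.du.tD) = L.du.xD := L.du.Xl_tD
  have exD : L.du.xD = 1 - L.du.κD := rfl
  rw [e2, exD] at this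
  have hβ := L.β_le'
  have hM := L.Mρ_pos
  have : L.Mρ * ((1 - h) - L.du.Hh L.du.tD) ≤ L.du.κD / 2 := by
    calc L.Mρ * ((1 - h) - L.du.Hh L.du.tD) ≤ L.Mρ * L.β := mul_le_mul_of_nonneg_left (by linarith [hz.2]) hM.le
      _ ≤ L.Mρ * (L.du.κD / (2 * L.Mρ)) := mul_le_mul_of_nonneg_left hβ hM.le
      _ = L.du.κD / 2 := by field_simp
  linarith

/-- On the blend zone the upper rise is un-saturated: `ρup = ρtᵘ ∘ (1 - ·)` near every point. [folklore] -/
theorem ρup_eventuallyEq {h : ℝ} (hh : h ∈ Icc (L.hDu - L.β) L.hDu) : L.ρup =ᶠ[𝓝 h] fun u ↦ L.du.ρt (1 - u) := by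
  have hlt : L.du.ρt (1 - h) < 1 - L.du.εℓ := by
    have := (L.ρt_mem_zone' hh).2; linarith [L.du.εℓ_le, L.du.κD_pos]
  have hc : Continuous fun u ↦ L.du.ρt (1 - u) := L.du.contDiff_ρt.continuous.comp (continuous_const.sub continuous_id)
  have ho : IsOpen {u | L.du.ρt (1 - u) < 1 - L.du.εℓ} := isOpen_lt hc continuous_const
  filter_upwards [ho.mem_nhds hlt] with u hu
  simp only [K1LoopData.ρup, K2LiteData.ρ₁]
  exact smoothMinConst_of_le L.du.εℓ_pos hu.le

/-- `zone_sub_win'` (auxiliary). [folklore] -/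
theorem zone_sub_win' {h : ℝ} (hh : h ∈ Icc (L.hDu - L.β) L.hDu) : h ∈ Ioo (0.15 : ℝ) 0.85 := by
  have h1 := L.hD_mem_win; have h2 := L.hDu_mem_win; have h3 := L.sep
  simp only [K1LoopData.hD, K1LoopData.hDu] at *
  exact ⟨by linarith [hh.1, h1.1, L.β_pos], h2.2.trans_le' hh.2⟩

/-- **The slope of the upper rise radius on the blend zone**:
`rup' = ρt' (1 - h) e + (1 - ρt (1 - h)) e'`, with `λ ≤ rup' ≤ s_max`. [folklore] -/
theorem hasDerivAt_rup_zone {h : ℝ} (hh : h ∈ Icc (L.hDu - L.β) L.hDu) :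
    HasDerivAt L.rup (deriv L.du.ρt (1 - h) * L.e h + (1 - L.du.ρt (1 - h)) * deriv L.e h) h := by
  have hw := L.zone_sub_win' hh
  have hρt : HasDerivAt (fun u ↦ L.du.ρt (1 - u)) (deriv L.du.ρt (1 - h) * (0 - 1)) h :=
    ((L.du.contDiff_ρt.differentiable (by simp) (1 - h)).hasDerivAt).comp h ((hasDerivAt_const h (1:ℝ)).sub (hasDerivAt_id h))
  have hρ : HasDerivAt L.ρup (deriv L.du.ρt (1 - h) * (0 - 1)) h := hρt.congr_of_eventuallyEq (L.ρup_eventuallyEq hh)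
  have he : HasDerivAt L.es (deriv L.e h) h := (L.hasDerivAt_e hw).congr_of_eventuallyEq (L.es_eventuallyEq hw)
  have h1 := ((hρ.const_sub 1).mul he).const_add 1
  have eρ : L.ρup h = L.du.ρt (1 - h) := (L.ρup_eventuallyEq hh).eq_of_nhds
  have ee : L.es h = L.e h := (L.es_eventuallyEq hw).eq_of_nhds
  refine (h1.congr_of_eventuallyEq (Eventually.of_forall fun u ↦ rfl)).congr_deriv ?_
  rw [eρ, ee]; ring

/-- `deriv_rup_ge_zone` (auxiliary). [folklore] -/
theorem deriv_rup_ge_zone {h : ℝ} (hh : h ∈ Icc (L.hDu - L.β) L.hDu) : L.lam ≤ deriv L.rup h := by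
  rw [(L.hasDerivAt_rup_zone hh).deriv]
  have hw := L.zone_sub_win' hh
  have hρ' := L.deriv_ρt_ge' hh
  have hρ := L.ρt_mem_zone' hh
  have he := L.e_ge h ⟨by linarith [hw.1], by linarith [hw.2]⟩
  have he' := abs_le.1 (L.e_deriv h hw)
  have hlam := L.lam_le'
  have hv : 0 < L.du.vmin / L.du.MH := div_pos L.du.vmin_pos L.du.MH_pos
  have h1 : L.du.vmin / L.du.MH * L.emin ≤ deriv L.du.ρt (1 - h) * L.e h := mul_le_mul hρ' he L.emin_pos.le (hv.le.trans hρ')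
  have h2 : -(L.du.κD * L.Me) ≤ (1 - L.du.ρt (1 - h)) * deriv L.e h := by
    have h1ρ : 0 ≤ 1 - L.du.ρt (1 - h) := by linarith [hρ.2, L.du.κD_pos]
    have h1ρ' : 1 - L.du.ρt (1 - h) ≤ L.du.κD := by rw [K2LiteData.xD] at hρ; linarith [hρ.1]
    have : -((1 - L.du.ρt (1 - h)) * L.Me) ≤ (1 - L.du.ρt (1 - h)) * deriv L.e h := by nlinarith [he'.1]
    nlinarith [L.Me_nonneg]
  have e3 : L.du.vmin * L.emin / L.du.MH = L.du.vmin / L.du.MH * L.emin := by ring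
  rw [e3] at hlam
  linarith

/-- `deriv_rup_le_zone` (auxiliary). [folklore] -/
theorem deriv_rup_le_zone {h : ℝ} (hh : h ∈ Icc (L.hDu - L.β) L.hDu) : deriv L.rup h ≤ L.smax := by
  rw [(L.hasDerivAt_rup_zone hh).deriv, smax]
  have hw := L.zone_sub_win' hh
  have hρ'le := L.ρt_deriv_le' (1 - h)
  have hρ'0 := L.du.deriv_ρt_nonneg (1 - h)
  have hρ := L.ρt_mem_zone' hh
  have he := L.e_le h ⟨by linarith [hw.1], by linarith [hw.2]⟩
  have he0 : 0 ≤ L.e h := L.emin_pos.le.trans (L.e_ge h ⟨by linarith [hw.1], by linarith [hw.2]⟩)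
  have he' := abs_le.1 (L.e_deriv h hw)
  have h1 : deriv L.du.ρt (1 - h) * L.e h ≤ L.Mρ * L.emax := mul_le_mul hρ'le he he0 L.Mρ_pos.le
  have h2 : (1 - L.du.ρt (1 - h)) * deriv L.e h ≤ L.du.κD * L.Me := by
    have h1ρ : 0 ≤ 1 - L.du.ρt (1 - h) := by linarith [hρ.2, L.du.κD_pos]
    have h1ρ' : 1 - L.du.ρt (1 - h) ≤ L.du.κD := by rw [K2LiteData.xD] at hρ; linarith [hρ.1]
    calc (1 - L.du.ρt (1 - h)) * deriv L.e h ≤ (1 - L.du.ρt (1 - h)) * L.Me := mul_le_mul_of_nonneg_left he'.2 h1ρ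
      _ ≤ L.du.κD * L.Me := mul_le_mul_of_nonneg_right h1ρ' L.Me_nonneg
  nlinarith [L.κD_le_one', L.Me_nonneg]

/-- **On the blend zone the upper rise radius stays above the gentle line** (and below the tip radius). [folklore] -/
theorem rmu_le_rup_zone {h : ℝ} (hh : h ∈ Icc (L.hDu - L.β) L.hDu) : L.rmu h ≤ L.rup h ∧ L.rup h ≤ L.rDu := by
  have hI : ∀ u ∈ Icc h L.hDu, u ∈ Icc (L.hDu - L.β) L.hDu := fun u hu ↦ ⟨hh.1.trans hu.1, hu.2⟩
  -- `u ↦ rup u - smax u` is non-increasing and `rup` non-decreasing on `[h, hDu]`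
  have hanti : AntitoneOn (fun u ↦ L.rup u - L.smax * u) (Icc h L.hDu) := by
    refine antitoneOn_of_deriv_nonpos (convex_Icc _ _)
      ((L.contDiff_rup.continuous.sub (continuous_const.mul continuous_id)).continuousOn)
      (((L.contDiff_rup.differentiable (by simp)).sub ((differentiable_const _).mul differentiable_id)).differentiableOn)
      fun u hu ↦ ?_
    rw [interior_Icc] at hu
    have h' : HasDerivAt (fun u ↦ L.rup u - L.smax * u) (deriv L.rup u - L.smax * 1) u :=
      ((L.contDiff_rup.differentiable (by simp) u).hasDerivAt).sub ((hasDerivAt_id u).const_mul _)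
    rw [h'.deriv]; linarith [L.deriv_rup_le_zone (hI u (Ioo_subset_Icc_self hu))]
  have hmono : MonotoneOn L.rup (Icc h L.hDu) := by
    refine monotoneOn_of_deriv_nonneg (convex_Icc _ _) L.contDiff_rup.continuous.continuousOn
      ((L.contDiff_rup.differentiable (by simp)).differentiableOn) fun u hu ↦ ?_
    rw [interior_Icc] at hu
    linarith [L.deriv_rup_ge_zone (hI u (Ioo_subset_Icc_self hu)), L.lam_pos]
  have h1 := hanti ⟨le_rfl, hh.2⟩ ⟨hh.2, le_rfl⟩ hh.2
  have h2 := hmono ⟨le_rfl, hh.2⟩ ⟨hh.2, le_rfl⟩ hh.2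
  simp only at h1
  rw [L.rup_hDu] at h1 h2
  refine ⟨?_, h2⟩
  rw [rmu]
  nlinarith [L.smax_pos, hh.1, hh.2, L.lam_pos, mul_nonneg L.lam_pos.le (sub_nonneg.2 hh.2)]

/-! ### The slope of the upper blend and of the clamped upper blend -/

/-- The derivative of the upper blend. [folklore] -/
theorem hasDerivAt_Bu (h : ℝ) :
    HasDerivAt L.Bu (deriv (smoothStep (L.hDu - L.β) L.hDu) h * (L.rup h - L.rmu h) +
      L.Tu h * deriv L.rup h + (1 - L.Tu h) * L.lam) h := by
  have hT : HasDerivAt L.Tu (deriv (smoothStep (L.hDu - L.β) L.hDu) h) h :=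
    ((contDiff_smoothStep _ _).differentiable (by simp) h).hasDerivAt
  have hr : HasDerivAt L.rup (deriv L.rup h) h := (L.contDiff_rup.differentiable (by simp) h).hasDerivAt
  have hm : HasDerivAt L.rmu (0 - L.lam * (0 - 1)) h := by
    have := ((hasDerivAt_const h L.hDu).sub (hasDerivAt_id h)).const_mul L.lam
    exact (hasDerivAt_const h _).sub (by simpa using this)
  have h1 := (hT.mul hr).add ((hT.const_sub 1).mul hm)
  refine (h1.congr_of_eventuallyEq (Eventually.of_forall fun u ↦ rfl)).congr_deriv ?_
  simp only [K1LoopData.Tu]; ring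

/-- **Below the upper tip the upper blend rises at rate at least `λ`.** [folklore] -/
theorem deriv_Bu_ge {h : ℝ} (hh : h ≤ L.hDu) : L.lam ≤ deriv L.Bu h := by
  rw [(L.hasDerivAt_Bu h).deriv]
  have hT := L.Tu_mem h
  have hT' : 0 ≤ deriv (smoothStep (L.hDu - L.β) L.hDu) h := deriv_smoothStep_nonneg L.Tu_lt h
  rcases le_or_gt (L.hDu - L.β) h with h1 | h1
  · have hz : h ∈ Icc (L.hDu - L.β) L.hDu := ⟨h1, hh⟩
    have hr := L.deriv_rup_ge_zone hz
    have hrm := (L.rmu_le_rup_zone hz).1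
    nlinarith [mul_le_mul_of_nonneg_left hr hT.1, mul_nonneg hT' (sub_nonneg.2 hrm)]
  · rw [K1LoopData.Tu, smoothStep_of_le L.Tu_lt h1.le, deriv_smoothStep_of_lt L.Tu_lt h1]; ring_nf; rfl

/-- Below the blend zone the upper blend is the gentle line: slope exactly `λ`. [folklore] -/
theorem deriv_Bu_of_le {h : ℝ} (hh : h ≤ L.hDu - L.β) : deriv L.Bu h = L.lam := by
  rw [(L.hasDerivAt_Bu h).deriv, K1LoopData.Tu, smoothStep_of_le L.Tu_lt hh]
  rcases hh.lt_or_eq with h1 | h1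
  · rw [deriv_smoothStep_of_lt L.Tu_lt h1]; ring
  · rw [h1, deriv_smoothStep_left]; ring

/-- Below the upper tip the upper blend is at most the upper tip radius. [folklore] -/
theorem Bu_le_rDu {h : ℝ} (hh : h ≤ L.hDu) : L.Bu h ≤ L.rDu := by
  rcases le_or_gt (L.hDu - L.β) h with h1 | h1
  · have hz := L.rmu_le_rup_zone ⟨h1, hh⟩
    have hT := L.Tu_mem h
    rw [Bu]; nlinarith [hz.1, hz.2, hT.1, hT.2]
  · rw [L.Bu_of_le h1.le, rmu]
    nlinarith [L.smax_pos, L.β_pos, L.lam_pos, mul_nonneg L.lam_pos.le (by linarith : (0:ℝ) ≤ L.hDu - h)]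

/-- On `[h_gᵘ, h_Dᵘ]` the upper blend is above the clamp threshold. [folklore] -/
theorem Bu_ge_of_hgu_le {h : ℝ} (hh : h ∈ Icc L.hgu L.hDu) : L.rlow + L.εf ≤ L.Bu h := by
  have hcl : L.rlow + L.εf ≤ L.rmu L.hgu := by
    have := L.clamp_up; simp only [rmu, rDu, smax, K1LoopData.hDu] at this ⊢; linarith
  have hrm : L.rmu L.hgu ≤ L.rmu h := by rw [rmu, rmu]; nlinarith [L.lam_pos, hh.1]
  rcases le_or_gt (L.hDu - L.β) h with h1 | h1
  · have hz := L.rmu_le_rup_zone ⟨h1, hh.2⟩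
    have hT := L.Tu_mem h
    rw [Bu]; nlinarith [hz.1, hT.1, hT.2]
  · rw [L.Bu_of_le h1.le]; linarith

/-- **The derivative of the clamped upper blend.** [folklore] -/
theorem hasDerivAt_rsu (h : ℝ) : HasDerivAt L.rsu (deriv L.cl (L.Bu h) * deriv L.Bu h) h := by
  have hB : HasDerivAt L.Bu (deriv L.Bu h) h := (L.contDiff_Bu.differentiable (by simp) h).hasDerivAt
  have hc : HasDerivAt L.cl (deriv L.cl (L.Bu h)) (L.Bu h) := (L.contDiff_cl.differentiable (by simp) _).hasDerivAt
  exact hc.comp h hB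

/-- **Below the upper tip the fingertip radius is non-decreasing.** [folklore] -/
theorem deriv_rsu_nonneg {h : ℝ} (hh : h ≤ L.hDu) : 0 ≤ deriv L.rsu h := by
  rw [(L.hasDerivAt_rsu h).deriv]
  exact mul_nonneg (L.deriv_cl_mem _).1 (L.lam_pos.le.trans (L.deriv_Bu_ge hh))

/-- **On `[h_gᵘ, h_Dᵘ]` the fingertip radius rises at rate at least `λ`.** [folklore] -/
theorem deriv_rsu_ge {h : ℝ} (hh : h ∈ Icc L.hgu L.hDu) : L.lam ≤ deriv L.rsu h := by
  rw [(L.hasDerivAt_rsu h).deriv, L.deriv_cl_of_ge (L.Bu_ge_of_hgu_le hh), one_mul]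
  exact L.deriv_Bu_ge hh.2

/-- **Below the blend zone the rise is gentle**: `rsu' ≤ (1 + C_T) λ`. [folklore] -/
theorem deriv_rsu_le {h : ℝ} (hh : h ≤ L.hDu - L.β) : deriv L.rsu h ≤ (1 + L.CT) * L.lam := by
  rw [(L.hasDerivAt_rsu h).deriv, L.deriv_Bu_of_le hh]
  have hc := L.deriv_cl_mem (L.Bu h)
  nlinarith [hc.1, hc.2, L.lam_pos]

/-- On `[h_gᵘ, h_Dᵘ]` the clamp is inactive: `rsu = Bᵘ`. [folklore] -/
theorem rsu_of_hgu_le {h : ℝ} (hh : h ∈ Icc L.hgu L.hDu) : L.rsu h = L.Bu h := by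
  rw [rsu, L.cl_of_ge (L.Bu_ge_of_hgu_le hh)]

/-- `rsu_hDu` (auxiliary). [folklore] -/
theorem rsu_hDu : L.rsu L.hDu = L.rDu := by
  have h1 := L.hgu_le; have h2 := L.β_pos
  have hle : L.hgu ≤ L.hDu := by simp only [K1LoopData.hDu]; linarith
  rw [L.rsu_of_hgu_le ⟨hle, le_rfl⟩, L.Bu_of_ge_hDu le_rfl, L.rup_hDu]

/-- **Below the upper tip the fingertip radius lies in `[r_low, r_Dᵘ]`.** [folklore] -/
theorem rsu_mem' {h : ℝ} (hh : h ≤ L.hDu) : L.rsu h ∈ Icc L.rlow L.rDu := by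
  refine ⟨L.rlow_le_cl _, (L.cl_le_max _).trans (max_le (L.Bu_le_rDu hh) ?_)⟩
  linarith [L.rlow_add_le_rDu, L.εf_pos]

end K1Loop2Data

end Literature.Topology.FourManifolds
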